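import Literature.MathematicalPhysics.QuantumFieldTheory.PlaquetteWeightSiteRP
import Literature.MathematicalPhysics.QuantumFieldTheory.LatticeGaugeStaticPotentialProofs
import HarnessLib

/-!
# Site-reflection positivity of a class-function plaquette weight in every lattice hyperplane

Companion of `PlaquetteWeightSiteRP` (reflection positivity of the Gibbs weight
`exp(J Σ_p w(U_p)) d(⊗ Haar)`, `w` a continuous inversion-invariant class function, for the time
reflection `Θ'` in the lattice hyperplanes `t = 0`, `t = L/2` of the even torus `(ℤ/Lℤ)^d`).
Chessboard estimates need the same positivity for the reflections in ALL lattice hyperplanes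
`xᵢ = k`, `xᵢ = k + L/2`, in every coordinate direction `i` (Fröhlich–Lieb 1978;
Fröhlich–Israel–Lieb–Simon 1978, Thm. 2.1 and §4; Kotecký–Shlosman 1982). These reflections are
the conjugates `S⁻¹ ∘ Θ' ∘ S` of `Θ'` by lattice symmetries `S` of the torus (a translation
followed by a permutation of the coordinate axes), and the Gibbs weight is invariant under `S`; so
positivity is transported:

* `integral_conj_conjReflect_mul_exp_nonneg` — for ANY measurable equivalence `S` of the
  configuration space preserving the Haar product and the energy `Σ_p w(U_p)`, and every bounded
  measurable `F` with `F ∘ S⁻¹` depending only on the links of the closed positive-time half,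
  `0 ≤ ∫ conj F(S⁻¹ Θ' S U) · F(U) · exp(J Σ_p w(U_p)) d(⊗ Haar)`;
* the lattice symmetries qualify: translations (`measurePreserving_torusConfigShift`,
  `sum_plaqW_torusConfigShift`) and axis permutations (`measurePreserving_configPerm`,
  `sum_plaqW_configPerm` — by the half-sum over ordered pairs of directions, using
  `w(U_{x,j,i}) = w(U_{x,i,j}⁻¹) = w(U_{x,i,j})` and `U_{x,i,i} = 1`), whence
  **`integral_conj_latticeReflect_mul_exp_nonneg`**: positivity for the reflection
  `Θ_{π,v} = (P_π T_v)⁻¹ Θ' (P_π T_v)` (`T_v` the translation by `v`, `P_π` the axis permutation),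
  i.e. the site reflection in direction `π⁻¹ 0` through the hyperplanes `x_{π⁻¹ 0} = -v_{π⁻¹0}` and
  `-v_{π⁻¹ 0} + L/2`, for observables `F` with `F ∘ (P_π T_v)⁻¹` supported in the closed
  positive-time half.

Everything here is proved; no facts (D-0014, D-0026). Written under the named fact
`Literature.MathematicalPhysics.QuantumLattice.enterShlosman_narrowWell_firstOrderTransition`
(van Enter–Shlosman 2005, Thm. 2: "Reflection Positivity … in planes passing through sites").

## References

* J. Fröhlich, R. Israel, E. H. Lieb, B. Simon, Comm. Math. Phys. 62 (1978) 1–34, Thm. 2.1, §4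
  [FrohlichIsraelLiebSimon1978].
* R. Kotecký, S. B. Shlosman, Comm. Math. Phys. 83 (1982) 493–515 [KoteckyShlosman1982].
* A. C. D. van Enter, S. B. Shlosman, Comm. Math. Phys. 255 (2005) 21–32 [VanEnterShlosman2005].
-/

open MeasureTheory Finset Complex
open scoped ComplexOrder ENNReal ComplexConjugate

namespace Literature.MathematicalPhysics.QuantumFieldTheory

noncomputable section

namespace WeightSiteRP

/-! ## Invariance of the energy under lattice symmetries -/

section Invariance

variable {d L : ℕ} {G : Type*} [Group G] (w : G → ℝ)

/-- The plaquette energy `Σ_p w(U_p)` as half the sum over sites and ORDERED pairs of directions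
of `w(U_{x,i,j}) - w(1)` (the diagonal terms vanish since `U_{x,i,i} = 1`, and
`w(U_{x,j,i}) = w(U_{x,i,j}⁻¹) = w(U_{x,i,j})`), plus the constant. [folklore] -/
theorem sum_plaqW_eq_half_sum [NeZero L] (hinv : ∀ g : G, w g⁻¹ = w g) (U : GaugeConfig d L G) :
    ∑ p : Plaquette d L, plaqW w U p =
      ∑ x : Site d L, ((1 / 2) * ∑ i : Fin d, ∑ j : Fin d, (w (plaquetteHolonomy U x i j) - w 1) +
        ∑ _q : {q : Fin d × Fin d // q.1 < q.2}, w 1) := by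
  unfold plaqW
  rw [Fintype.sum_prod_type]
  refine Finset.sum_congr rfl fun x _ => ?_
  rw [← StaticPotential.sum_lt_eq_half_sum (fun i j => w (plaquetteHolonomy U x i j) - w 1)
    (fun i j => by rw [plaquetteHolonomy_swap U x i j, hinv]) (fun i => by
      rw [plaquetteHolonomy_self, sub_self]), ← Finset.sum_add_distrib]
  simp

/-- **The plaquette energy is invariant under permutations of the coordinate axes.** [folklore] -/
theorem sum_plaqW_configPerm [MeasurableSpace G] [NeZero L] (hinv : ∀ g : G, w g⁻¹ = w g)
    (π : Equiv.Perm (Fin d)) (U : GaugeConfig d L G) :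
    ∑ p : Plaquette d L, plaqW w (configPerm π U) p = ∑ p : Plaquette d L, plaqW w U p := by
  rw [sum_plaqW_eq_half_sum w hinv, sum_plaqW_eq_half_sum w hinv]
  simp only [plaquetteHolonomy_configPerm]
  refine Fintype.sum_equiv (sitePerm π.symm) _ _ fun x => ?_
  congr 2
  exact Fintype.sum_equiv π.symm _ _ fun i => Fintype.sum_equiv π.symm _ _ fun j => rfl

/-- **The plaquette energy is invariant under lattice translations.** [folklore] -/
theorem sum_plaqW_torusConfigShift [MeasurableSpace G] [NeZero L] (v : Site d L)
    (U : GaugeConfig d L G) :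
    ∑ p : Plaquette d L, plaqW w (torusConfigShift v U) p = ∑ p : Plaquette d L, plaqW w U p := by
  simp only [plaqW, plaquetteHolonomy_torusConfigShift]
  exact Fintype.sum_equiv ((Equiv.subRight v).prodCongr (Equiv.refl _)) _ _ fun p => rfl

variable [MeasurableSpace G] [TopologicalSpace G] [IsTopologicalGroup G] [CompactSpace G]
  [BorelSpace G]

/-- Axis permutations preserve the Haar product. [folklore] -/
theorem measurePreserving_configPerm [NeZero L] (π : Equiv.Perm (Fin d)) :
    MeasurePreserving (configPerm (G := G) (L := L) π)
      (Measure.pi fun _ : Edge d L => haarProbability G)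
      (Measure.pi fun _ : Edge d L => haarProbability G) :=
  measurePreserving_arrowCongr' (fun _ : Edge d L => haarProbability G)
    (fun _ : Edge d L => haarProbability G) (edgePerm π) (MeasurableEquiv.refl G)
    fun _ => MeasurePreserving.id _

/-- Lattice translations preserve the Haar product. [folklore] -/
theorem measurePreserving_torusConfigShift [NeZero L] (v : Site d L) :
    MeasurePreserving (torusConfigShift (G := G) v)
      (Measure.pi fun _ : Edge d L => haarProbability G)
      (Measure.pi fun _ : Edge d L => haarProbability G) :=
  measurePreserving_arrowCongr' (fun _ : Edge d L => haarProbability G)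
    (fun _ : Edge d L => haarProbability G) (torusEdgeShift v) (MeasurableEquiv.refl G)
    fun _ => MeasurePreserving.id _

end Invariance

end WeightSiteRP

/-! ## Transport of reflection positivity along a symmetry of the weight -/

section Transport

variable {d L : ℕ} {G : Type*} [Group G] [TopologicalSpace G] [IsTopologicalGroup G]
  [CompactSpace G] [MeasurableSpace G] [BorelSpace G] [SecondCountableTopology G]

/-- **Reflection positivity for a conjugate reflection.** Let `S` be a measurable equivalence of
the torus configuration space preserving the Haar product and the plaquette energy `Σ_p w(U_p)`
(`w` a continuous inversion-invariant class function), `L` even, `J` real. Then for every bounded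
measurable `F` such that `F ∘ S⁻¹` depends only on the links of the closed positive-time half,
`0 ≤ ∫ conj F(S⁻¹ Θ' S U) · F(U) · exp(J Σ_p w(U_p)) d(⊗ Haar)(U)`: the Gibbs weight is reflection
positive for the conjugate reflection `S⁻¹ Θ' S` on the cone `{F : F ∘ S⁻¹ positive-time}`
(change of variables `U = S⁻¹ V` and `integral_conj_negReflect_mul_exp_nonneg`).
[cite: FrohlichIsraelLiebSimon1978, Thm. 2.1 (reflection through sites, any lattice hyperplane)] -/
theorem integral_conj_conjReflect_mul_exp_nonneg [NeZero d] [NeZero L] (hL : Even L)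
    {w : G → ℝ} (hw : Continuous w) (hcl : ∀ g h : G, w (h * g * h⁻¹) = w g)
    (hinv : ∀ g : G, w g⁻¹ = w g) (J : ℝ)
    (S : GaugeConfig d L G ≃ᵐ GaugeConfig d L G)
    (hS : MeasurePreserving S (Measure.pi fun _ : Edge d L => haarProbability G)
      (Measure.pi fun _ : Edge d L => haarProbability G))
    (hHS : ∀ U : GaugeConfig d L G,
      ∑ p : Plaquette d L, w (plaquetteHolonomy (S U) p.1 p.2.1.1 p.2.1.2) =
        ∑ p : Plaquette d L, w (plaquetteHolonomy U p.1 p.2.1.1 p.2.1.2))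
    (F : GaugeConfig d L G → ℂ) (hF : Measurable F) (hFb : ∃ C : ℝ, ∀ U, ‖F U‖ ≤ C)
    (hFdep : DependsOn (F ∘ S.symm)
      ((WilsonSiteRP.sitePosEdges ∪ WilsonSiteRP.sharedEdges : Finset (Edge d L)) : Set (Edge d L))) :
    0 ≤ ∫ U : GaugeConfig d L G, conj (F (S.symm (S U).negReflect)) * F U *
        (Real.exp (J * ∑ p : Plaquette d L, w (plaquetteHolonomy U p.1 p.2.1.1 p.2.1.2)) : ℂ)
      ∂(Measure.pi fun _ : Edge d L => haarProbability G) := by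
  set μ : Measure (GaugeConfig d L G) := Measure.pi fun _ : Edge d L => haarProbability G with hμ
  obtain ⟨C, hC⟩ := hFb
  -- the transported observable
  have hF' : Measurable (F ∘ S.symm) := hF.comp S.symm.measurable
  have hF'b : ∃ C : ℝ, ∀ V, ‖(F ∘ S.symm) V‖ ≤ C := ⟨C, fun V => hC _⟩
  have hpos := integral_conj_negReflect_mul_exp_nonneg hL hw hcl hinv J (F ∘ S.symm) hF' hF'b hFdep
  -- change of variables `U = S⁻¹ V`
  have hHS' : ∀ V : GaugeConfig d L G,
      ∑ p : Plaquette d L, w (plaquetteHolonomy (S.symm V) p.1 p.2.1.1 p.2.1.2) =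
        ∑ p : Plaquette d L, w (plaquetteHolonomy V p.1 p.2.1.1 p.2.1.2) := fun V => by
    rw [← hHS (S.symm V), S.apply_symm_apply]
  have hchange := (hS.symm S).integral_comp' (f := S.symm) (g := fun U : GaugeConfig d L G =>
      conj (F (S.symm (S U).negReflect)) * F U *
        (Real.exp (J * ∑ p : Plaquette d L, w (plaquetteHolonomy U p.1 p.2.1.1 p.2.1.2)) : ℂ))
  rw [← hchange]
  simp only [S.apply_symm_apply, hHS', Function.comp_apply] at hpos ⊢
  exact hpos

/-- **Site-reflection positivity in every lattice hyperplane** (all directions, all positions).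
For a permutation `π` of the axes and a translation vector `v`, let `S = P_π ∘ T_v`
(`configPerm π ∘ torusConfigShift v`); the conjugate `S⁻¹ Θ' S` of the time reflection is the
reflection in the lattice hyperplanes orthogonal to the axis `π⁻¹ 0` through the sites with
`π⁻¹ 0`-coordinate `-v_{π⁻¹ 0}` and `-v_{π⁻¹ 0} + L/2`. For `L` even, any real `J`, any
continuous inversion-invariant class function `w` and every bounded measurable `F` with
`F ∘ S⁻¹` supported on the links of the closed positive-time half:
`0 ≤ ∫ conj F(S⁻¹ Θ' S U) · F(U) · exp(J Σ_p w(U_p)) d(⊗ Haar)(U)`.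
[cite: FrohlichIsraelLiebSimon1978, Thm. 2.1 and §4 (reflections in all lattice hyperplanes, as used for chessboard estimates)] -/
theorem integral_conj_latticeReflect_mul_exp_nonneg [NeZero d] [NeZero L] (hL : Even L)
    {w : G → ℝ} (hw : Continuous w) (hcl : ∀ g h : G, w (h * g * h⁻¹) = w g)
    (hinv : ∀ g : G, w g⁻¹ = w g) (J : ℝ) (π : Equiv.Perm (Fin d)) (v : Site d L)
    (F : GaugeConfig d L G → ℂ) (hF : Measurable F) (hFb : ∃ C : ℝ, ∀ U, ‖F U‖ ≤ C)
    (hFdep : DependsOn (F ∘ ((torusConfigShift v).trans (configPerm π)).symm)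
      ((WilsonSiteRP.sitePosEdges ∪ WilsonSiteRP.sharedEdges : Finset (Edge d L)) : Set (Edge d L))) :
    0 ≤ ∫ U : GaugeConfig d L G,
        conj (F (((torusConfigShift v).trans (configPerm π)).symm
          (((torusConfigShift v).trans (configPerm π)) U).negReflect)) * F U *
        (Real.exp (J * ∑ p : Plaquette d L, w (plaquetteHolonomy U p.1 p.2.1.1 p.2.1.2)) : ℂ)
      ∂(Measure.pi fun _ : Edge d L => haarProbability G) := by
  refine integral_conj_conjReflect_mul_exp_nonneg hL hw hcl hinv J _
    ((WeightSiteRP.measurePreserving_torusConfigShift v).trans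
      (WeightSiteRP.measurePreserving_configPerm π)) (fun U => ?_) F hF hFb hFdep
  have h1 := WeightSiteRP.sum_plaqW_configPerm w hinv π (torusConfigShift v U)
  have h2 := WeightSiteRP.sum_plaqW_torusConfigShift w v U
  simp only [WeightSiteRP.plaqW] at h1 h2
  rw [MeasurableEquiv.trans_apply, h1, h2]

end Transport

end

end Literature.MathematicalPhysics.QuantumFieldTheory
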